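import Literature.MathematicalPhysics.QuantumFieldTheory.TphiSeminormExp
import Mathlib.Analysis.Complex.Exponential
import Mathlib.Analysis.SpecialFunctions.ExpDeriv
import Mathlib.Analysis.Calculus.Deriv.MeanValue
import HarnessLib

/-!
# Second-order bound for the exponential in the `T_φ`-seminorm:
# `‖e^F − 1 − F‖_{T_φ(𝔥)} ≤ e^{‖F‖_{T_φ}} − 1 − ‖F‖_{T_φ} ≤ ‖F‖²_{T_φ} e^{‖F‖_{T_φ}}`

[ABKM19] Lemma 9.3 proves that `E(H) = e^{H}` is smooth into the strong norm with `D²E(H)(Ḣ,Ḣ) =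
e^{H}Ḣ²` bounded on a ball, so the second-order Taylor remainder `E(H) − 1 − H` is `O(‖H‖²)`; at the
level of one block this is a bound on `‖e^{F} − 1 − F‖_{T_φ}`, `F = H(B, ·)`.  We prove the sharp
`T_φ`-seminorm analogue of `‖e^z − 1 − z‖ ≤ e^{|z|} − 1 − |z|` by the Bell-majorant method of
`TphiSeminormExp`: with `G₁ = e^F − 1`, `D(e^F − 1 − F) = G₁ · DF`, so by Leibniz
`‖D^{n+1}(e^F−1−F)(φ)‖ ≤ Σ_i C(n,i) ‖DⁱG₁(φ)‖ ‖D^{n+1−i}F(φ)‖` with `‖G₁(φ)‖ ≤ e^{|z|} − 1` (`z = F(φ)`)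
and `‖DⁱG₁(φ)‖ = ‖Dⁱe^F(φ)‖ ≤ e^{|z|}uᵢ` (`i ≥ 1`, Bell majorant `u`); the exponential generating
functions then satisfy `T' ≤ (e^{|z|+g} − 1)g'`, whence `T(𝔥) ≤ e^{|z|+g(𝔥)} − g(𝔥) − e^{|z|}` and, adding
the order-zero term `‖e^z − 1 − z‖ ≤ e^{|z|} − 1 − |z|`, the total `e^{a} − 1 − a`, `a = |z| + g(𝔥) = ‖F‖_{T_φ}`.

* `sum_bellMajorant_second_le` — the generating inequality;
* **`tphiSeminorm_cexp_sub_one_sub_le_exp`** — `‖e^F − 1 − F‖_{T_φ} ≤ e^{‖F‖_{T_φ}} − 1 − ‖F‖_{T_φ}`;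
* **`tphiSeminorm_cexp_sub_one_sub_le`** — the cruder `≤ ‖F‖²_{T_φ} e^{‖F‖_{T_φ}}`.

Everything is proved; no named fact.

## References
* S. Adams, S. Buchholz, R. Kotecký, S. Müller, arXiv:1910.13564, Lemma 9.3 (9.13) [AdamsBuchholzKoteckyMuller2019].
* R. Bauerschmidt, D. C. Brydges, G. Slade, LNM 2242 (2019), Lemma 7.4.1, Prop. 7.4.2
  [BauerschmidtBrydgesSlade2019RG].
-/

noncomputable section

namespace Literature.MathematicalPhysics.QuantumFieldTheory

open Finset Set
open scoped Nat

/-! ### `e^a − 1 − a ≤ a² e^a` -/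

/-- `e^a − 1 − a ≤ a² e^a` for real `a ≥ 0`. [folklore] -/
private theorem exp_sub_one_sub_le_sq_mul_exp {a : ℝ} (ha : 0 ≤ a) :
    Real.exp a - 1 - a ≤ a ^ 2 * Real.exp a := by
  have h := Complex.norm_exp_sub_sum_le_norm_mul_exp (a : ℂ) 2
  have hs : ∑ m ∈ range 2, (a : ℂ) ^ m / (m.factorial : ℂ) = 1 + (a : ℂ) := by
    simp [Finset.sum_range_succ]
  rw [hs] at h
  have hn : ‖(a : ℂ)‖ = a := by rw [Complex.norm_real, Real.norm_eq_abs, abs_of_nonneg ha]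
  rw [hn] at h
  have hre : Complex.exp (a : ℂ) - (1 + (a : ℂ)) = ((Real.exp a - 1 - a : ℝ) : ℂ) := by
    push_cast; ring
  rw [hre, Complex.norm_real, Real.norm_eq_abs] at h
  exact (le_abs_self _).trans h

/-! ### The generating inequality at second order -/

/-- **Generating inequality, second order**: for nonnegative `f`, `z₀ ≥ 0`, `𝔥 ≥ 0`, the Bell majorant `u`
of `f` and `V₀ = e^{z₀} − 1`, `Vᵢ = e^{z₀}uᵢ` (`i ≥ 1`):
`Σ_{n<N} 𝔥^{n+1}/(n+1)! Σ_{i≤n} C(n,i) Vᵢ f_{n+1−i} ≤ e^{z₀+w} − w − e^{z₀}`, `w = Σ_{k<N} f_{k+1}𝔥^{k+1}/(k+1)!`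
(from `T' ≤ (e^{z₀+g} − 1)g'` by monotonicity of `e^{z₀+g} − g − T`).
[cite: BauerschmidtBrydgesSlade2019RG, Prop. 7.4.2] -/
theorem sum_bellMajorant_second_le {f : ℕ → ℝ} (hf : ∀ k, 0 ≤ f k) {z₀ : ℝ} (hz₀ : 0 ≤ z₀) (N : ℕ)
    {𝔥 : ℝ} (h𝔥 : 0 ≤ 𝔥) :
    ∑ n ∈ range N, 𝔥 ^ (n + 1) / ((n + 1)! : ℝ) *
        ∑ i ∈ range (n + 1), (n.choose i : ℝ) *
          (if i = 0 then Real.exp z₀ - 1 else Real.exp z₀ * bellMajorant f i) * f (n + 1 - i) ≤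
      Real.exp (z₀ + ∑ k ∈ range N, f (k + 1) * 𝔥 ^ (k + 1) / ((k + 1)! : ℝ)) -
        (∑ k ∈ range N, f (k + 1) * 𝔥 ^ (k + 1) / ((k + 1)! : ℝ)) - Real.exp z₀ := by
  rcases N with _ | M
  · simp
  set u := bellMajorant f with hu
  set V : ℕ → ℝ := fun i => if i = 0 then Real.exp z₀ - 1 else Real.exp z₀ * u i with hV
  have hun : ∀ n, 0 ≤ u n := bellMajorant_nonneg hf
  have hez : 1 ≤ Real.exp z₀ := Real.one_le_exp hz₀
  have hVn : ∀ i, 0 ≤ V i := fun i => by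
    simp only [hV]; split_ifs
    · linarith
    · exact mul_nonneg (Real.exp_pos _).le (hun i)
  -- the coefficients `c_n = Σ_i C(n,i) V_i f_{n+1-i}` and the shifted sequence `c'`
  set c : ℕ → ℝ := fun n => ∑ i ∈ range (n + 1), (n.choose i : ℝ) * V i * f (n + 1 - i) with hc
  have hcn : ∀ n, 0 ≤ c n := fun n => sum_nonneg fun i _ => mul_nonneg (mul_nonneg (by positivity) (hVn i)) (hf _)
  set c' : ℕ → ℝ := fun n => if n = 0 then 0 else c (n - 1) with hc'
  set T : ℝ → ℝ := fun t => ∑ n ∈ range (M + 1 + 1), c' n * t ^ n / (n ! : ℝ) with hT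
  set T' : ℝ → ℝ := fun t => ∑ n ∈ range (M + 1), c n * t ^ n / (n ! : ℝ) with hT'
  set cg : ℕ → ℝ := fun n => if n = 0 then 0 else f n with hcg
  set g : ℝ → ℝ := fun t => ∑ n ∈ range (M + 1 + 1), cg n * t ^ n / (n ! : ℝ) with hg
  set g' : ℝ → ℝ := fun t => ∑ n ∈ range (M + 1), f (n + 1) * t ^ n / (n ! : ℝ) with hg'
  have hTd : ∀ t, HasDerivAt T (T' t) t := by
    intro t
    have h := hasDerivAt_sum_pow_div_factorial c' (M + 1) t
    have e : (∑ n ∈ range (M + 1), c' (n + 1) * t ^ n / (n ! : ℝ)) = T' t :=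
      sum_congr rfl fun n _ => by simp [hc']
    rw [e] at h
    exact h
  have hgd : ∀ t, HasDerivAt g (g' t) t := by
    intro t
    have h := hasDerivAt_sum_pow_div_factorial cg (M + 1) t
    have e : (∑ n ∈ range (M + 1), cg (n + 1) * t ^ n / (n ! : ℝ)) = g' t :=
      sum_congr rfl fun n _ => by simp [hcg]
    rw [e] at h
    exact h
  have hg_eq : ∀ t, g t = ∑ k ∈ range (M + 1), f (k + 1) * t ^ (k + 1) / ((k + 1)! : ℝ) := by
    intro t
    simp only [hg]
    rw [sum_range_succ']
    simp [hcg]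
  have hT_eq : ∀ t, T t = ∑ n ∈ range (M + 1), t ^ (n + 1) / ((n + 1)! : ℝ) * c n := by
    intro t
    simp only [hT]
    rw [sum_range_succ']
    simp only [hc', Nat.add_sub_cancel, if_neg (Nat.succ_ne_zero _), if_pos rfl, zero_mul, zero_div,
      add_zero]
    exact sum_congr rfl fun n _ => by ring
  -- nonnegativity on `t ≥ 0`
  have hg'n : ∀ t, 0 ≤ t → 0 ≤ g' t := fun t ht => sum_nonneg fun n _ => by
    have := hf (n + 1); positivity
  have hgn : ∀ t, 0 ≤ t → 0 ≤ g t := fun t ht => by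
    rw [hg_eq]; exact sum_nonneg fun n _ => by have := hf (n + 1); positivity
  -- the key differential inequality `T' ≤ (e^{z₀ + g} − 1) g'` on `t ≥ 0`
  have hkey : ∀ t, 0 ≤ t → T' t ≤ (Real.exp (z₀ + g t) - 1) * g' t := by
    intro t ht
    have e1 : T' t = ∑ n ∈ range (M + 1), t ^ n / (n ! : ℝ) *
        ∑ i ∈ range (n + 1), (n.choose i : ℝ) * V i * f (n - i + 1) := by
      simp only [hT']
      refine sum_congr rfl fun n _ => ?_
      rw [mul_div_assoc, mul_comm]
      congr 1
      refine sum_congr rfl fun i hi => ?_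
      have : i ≤ n := Nat.lt_succ_iff.1 (mem_range.1 hi)
      rw [show n + 1 - i = n - i + 1 by omega]
    have e2 := sum_choose_weighted_le_mul M ht (a := V) (b := fun j => f (j + 1)) hVn (fun j => hf _)
    -- `Σ_{i ≤ M} tⁱ/i! Vᵢ ≤ e^{z₀ + g(t)} − 1`
    have e3 : (∑ i ∈ range (M + 1), t ^ i / (i ! : ℝ) * V i) ≤ Real.exp (z₀ + g t) - 1 := by
      have hbell := sum_bellMajorant_le_exp hf M ht
      rw [← hu] at hbell
      -- the exponent with `M` terms is at most `g t`
      have hexp_le : Real.exp (∑ k ∈ range M, f (k + 1) * t ^ (k + 1) / ((k + 1)! : ℝ)) ≤ Real.exp (g t) := by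
        refine Real.exp_le_exp.2 ?_
        rw [hg_eq]
        exact sum_le_sum_of_subset_of_nonneg (range_mono (by omega)) fun k _ _ => by
          have := hf (k + 1); positivity
      have hsplit : ∑ i ∈ range (M + 1), t ^ i / (i ! : ℝ) * V i =
          (Real.exp z₀ - 1) + Real.exp z₀ * ∑ i ∈ range M, u (i + 1) * t ^ (i + 1) / ((i + 1)! : ℝ) := by
        rw [sum_range_succ', mul_sum]
        simp only [hV, if_pos rfl, Nat.succ_ne_zero, if_false, pow_zero, Nat.factorial_zero,
          Nat.cast_one, div_one, one_mul]
        rw [add_comm]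
        congr 1
        exact sum_congr rfl fun i _ => by ring
      have hbell' : 1 + ∑ i ∈ range M, u (i + 1) * t ^ (i + 1) / ((i + 1)! : ℝ) ≤ Real.exp (g t) := by
        have : ∑ n ∈ range (M + 1), u n * t ^ n / (n ! : ℝ) =
            1 + ∑ i ∈ range M, u (i + 1) * t ^ (i + 1) / ((i + 1)! : ℝ) := by
          rw [sum_range_succ']; simp [hu, add_comm]
        rw [← this]
        exact hbell.trans hexp_le
      rw [hsplit, Real.exp_add]
      have hep : 0 < Real.exp z₀ := Real.exp_pos _
      nlinarith
    have e4 : (∑ j ∈ range (M + 1), t ^ j / (j ! : ℝ) * f (j + 1)) = g' t := by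
      simp only [hg']
      exact sum_congr rfl fun j _ => by ring
    have hfac0 : 0 ≤ ∑ i ∈ range (M + 1), t ^ i / (i ! : ℝ) * V i :=
      sum_nonneg fun i _ => by have := hVn i; positivity
    rw [e1]
    calc _ ≤ (∑ i ∈ range (M + 1), t ^ i / (i ! : ℝ) * V i) *
          (∑ j ∈ range (M + 1), t ^ j / (j ! : ℝ) * f (j + 1)) := e2
      _ ≤ (Real.exp (z₀ + g t) - 1) * g' t := by
          rw [e4]
          exact mul_le_mul_of_nonneg_right e3 (hg'n t ht)
  -- monotonicity of `Φ = e^{z₀ + g} − g − T` on `[0, ∞)`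
  set Φ : ℝ → ℝ := fun t => Real.exp (z₀ + g t) - g t - T t with hΦ
  have hΦd : ∀ t, HasDerivAt Φ (Real.exp (z₀ + g t) * g' t - g' t - T' t) t := by
    intro t
    have h1 : HasDerivAt (fun t => z₀ + g t) (g' t) t := by
      simpa using (hgd t).const_add z₀
    have h2 := h1.exp
    exact (h2.sub (hgd t)).sub (hTd t)
  have hmono : MonotoneOn Φ (Ici 0) := by
    refine monotoneOn_of_hasDerivWithinAt_nonneg (convex_Ici 0) ?_ ?_ ?_
      (f' := fun t => Real.exp (z₀ + g t) * g' t - g' t - T' t)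
    · exact (continuous_iff_continuousAt.2 fun t => (hΦd t).continuousAt).continuousOn
    · intro t _; exact (hΦd t).hasDerivWithinAt
    · intro t ht
      rw [interior_Ici] at ht
      have hk := hkey t (le_of_lt ht)
      nlinarith
  have hT0 : T 0 = 0 := by
    simp only [hT]
    rw [sum_eq_single 0 (fun n _ hn => by simp [zero_pow hn]) (by simp)]
    simp [hc']
  have hg0 : g 0 = 0 := by
    simp only [hg]
    exact sum_eq_zero fun n _ => by
      rcases Nat.eq_zero_or_pos n with rfl | hn
      · simp [hcg]
      · simp [zero_pow hn.ne']
  have hΦ0 : Φ 0 = Real.exp z₀ := by simp only [hΦ]; rw [hT0, hg0, add_zero, sub_zero, sub_zero]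
  have hΦh : Real.exp z₀ ≤ Φ 𝔥 := by
    rw [← hΦ0]; exact hmono (mem_Ici.2 le_rfl) (mem_Ici.2 h𝔥) h𝔥
  -- conclude
  have hmain : T 𝔥 ≤ Real.exp (z₀ + g 𝔥) - g 𝔥 - Real.exp z₀ := by
    simp only [hΦ] at hΦh; linarith
  rw [hT_eq 𝔥, hg_eq 𝔥] at hmain
  have hre : ∑ n ∈ range (M + 1), 𝔥 ^ (n + 1) / ((n + 1)! : ℝ) *
      ∑ i ∈ range (n + 1), (n.choose i : ℝ) * (if i = 0 then Real.exp z₀ - 1 else Real.exp z₀ * bellMajorant f i) *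
        f (n + 1 - i) = ∑ n ∈ range (M + 1), 𝔥 ^ (n + 1) / ((n + 1)! : ℝ) * c n := by
    rfl
  rw [hre]
  exact hmain

/-! ### The `T_φ`-seminorm of `e^F − 1 − F` -/

section Tphi

variable {E : Type*} [NormedAddCommGroup E] [NormedSpace ℝ E]

set_option maxSynthPendingDepth 2 in -- operator norm on the nested `ℂ →L (E →L ℂ) →L (E →L ℂ)`
/-- **`‖e^F − 1 − F‖_{T_φ(𝔥)} ≤ e^{‖F‖_{T_φ(𝔥)}} − 1 − ‖F‖_{T_φ(𝔥)}`** for complex `F` of class `C^N`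
(Taylor order `N`): the `T_φ` analogue of `|e^z − 1 − z| ≤ e^{|z|} − 1 − |z|`.
[cite: AdamsBuchholzKoteckyMuller2019, Lemma 9.3 (9.13)] -/
theorem tphiSeminorm_cexp_sub_one_sub_le_exp (N : ℕ) {𝔥 : ℝ} (h𝔥 : 0 ≤ 𝔥) {F : E → ℂ}
    (hF : ContDiff ℝ N F) (φ : E) :
    tphiSeminorm N 𝔥 (fun x => Complex.exp (F x) - 1 - F x) φ ≤
      Real.exp (tphiSeminorm N 𝔥 F φ) - 1 - tphiSeminorm N 𝔥 F φ := by
  set z := F φ with hz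
  set a := tphiSeminorm N 𝔥 F φ with ha
  -- order zero
  have h0 : ‖Complex.exp z - 1 - z‖ ≤ Real.exp ‖z‖ - 1 - ‖z‖ := by
    have h := Complex.norm_exp_sub_sum_le_exp_norm_sub_sum z 2
    have hs : ∑ m ∈ range 2, z ^ m / (m.factorial : ℂ) = 1 + z := by simp [Finset.sum_range_succ]
    have hs' : ∑ m ∈ range 2, ‖z‖ ^ m / (m.factorial : ℝ) = 1 + ‖z‖ := by simp [Finset.sum_range_succ]
    rw [hs, hs'] at h
    have e : Complex.exp z - (1 + z) = Complex.exp z - 1 - z := by ring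
    rw [e] at h
    linarith
  rcases Nat.eq_zero_or_pos N with rfl | hN
  · rw [tphiSeminorm_zero_order, ha, tphiSeminorm_zero_order]
    exact h0
  -- the players
  set G : E → ℂ := fun x => Complex.exp (F x) with hG
  set G₁ : E → ℂ := fun x => Complex.exp (F x) - 1 with hG₁
  set G₂ : E → ℂ := fun x => Complex.exp (F x) - 1 - F x with hG₂
  set f : ℕ → ℝ := fun k => ‖iteratedFDeriv ℝ k F φ‖ with hf
  have hfn : ∀ k, 0 ≤ f k := fun k => norm_nonneg _
  set u := bellMajorant f with hu
  have hdiff : Differentiable ℝ F := hF.differentiable (by exact_mod_cast hN.ne')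
  have hGc : ContDiff ℝ N G := hF.cexp
  have hG₁c : ContDiff ℝ N G₁ := hF.cexp.sub contDiff_const
  have hGF : ∀ x, fderiv ℝ G x = (ContinuousLinearMap.mul ℝ ℂ (G x)).comp (fderiv ℝ F x) := by
    intro x
    rw [(hdiff x).hasFDerivAt.cexp.fderiv]
    ext v
    simp [hG]
  have hmaj := norm_iteratedFDeriv_le_bellMajorant hF hGc hGF φ
  have hGφ : ‖G φ‖ ≤ Real.exp ‖z‖ := by
    simp only [hG]; rw [Complex.norm_exp]; exact Real.exp_le_exp.2 (Complex.re_le_norm z)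
  -- `‖DⁱG₁(φ)‖ ≤ Vᵢ`
  set V : ℕ → ℝ := fun i => if i = 0 then Real.exp ‖z‖ - 1 else Real.exp ‖z‖ * u i with hV
  have hG₁b : ∀ i, i ≤ N → ‖iteratedFDeriv ℝ i G₁ φ‖ ≤ V i := by
    intro i hi
    rcases Nat.eq_zero_or_pos i with rfl | hi0
    · simp only [hV, if_pos rfl, norm_iteratedFDeriv_zero, hG₁]
      have h := Complex.norm_exp_sub_sum_le_exp_norm_sub_sum z 1
      simpa using h
    · have hne : i ≠ 0 := hi0.ne'
      simp only [hV, if_neg hne]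
      have h1 : iteratedFDeriv ℝ i G₁ φ = iteratedFDeriv ℝ i G φ := by
        have e : G₁ = G + fun _ => (-1 : ℂ) := by funext x; simp [hG₁, hG, sub_eq_add_neg]
        have hi' : ((i : ℕ) : WithTop ℕ∞) ≤ N := by exact_mod_cast hi
        rw [e, iteratedFDeriv_add_apply (hGc.contDiffAt.of_le hi') contDiffAt_const,
          iteratedFDeriv_const_of_ne hne, Pi.zero_apply, add_zero]
      rw [h1]
      exact (hmaj i hi).trans (mul_le_mul_of_nonneg_right hGφ (bellMajorant_nonneg hfn i))
  -- `DG₂ = B(G₁, DF)`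
  set B : ℂ →L[ℝ] (E →L[ℝ] ℂ) →L[ℝ] (E →L[ℝ] ℂ) :=
    (ContinuousLinearMap.compL ℝ E ℂ ℂ).comp (ContinuousLinearMap.mul ℝ ℂ) with hB
  have hBn : ‖B‖ ≤ 1 := by
    refine (ContinuousLinearMap.opNorm_comp_le _ _).trans ?_
    have h1 := ContinuousLinearMap.norm_compL_le (𝕜 := ℝ) (E := E) (Fₗ := ℂ) (Gₗ := ℂ)
    have h2 := ContinuousLinearMap.opNorm_mul_le ℝ ℂ
    nlinarith [norm_nonneg (ContinuousLinearMap.compL ℝ E ℂ ℂ), norm_nonneg (ContinuousLinearMap.mul ℝ ℂ)]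
  have hfd : fderiv ℝ G₂ = fun y => B (G₁ y) (fderiv ℝ F y) := by
    funext y
    have h := (((hdiff y).hasFDerivAt.cexp).sub_const (1 : ℂ)).sub (hdiff y).hasFDerivAt
    have e : G₂ = (fun x => Complex.exp (F x) - 1) - F := by funext x; simp [hG₂]
    rw [e, h.fderiv]
    ext v
    simp [hB, hG₁]
  -- `‖D^{m+1}G₂(φ)‖ ≤ Σ_i C(m,i) V_i f_{m+1-i}`
  have hder : ∀ m, m + 1 ≤ N → ‖iteratedFDeriv ℝ (m + 1) G₂ φ‖ ≤
      ∑ i ∈ range (m + 1), (m.choose i : ℝ) * V i * f (m + 1 - i) := by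
    intro m hm
    have hmN : (m : WithTop ℕ∞) + 1 ≤ (N : WithTop ℕ∞) := by exact_mod_cast hm
    have hG₁m : ContDiff ℝ m G₁ := hG₁c.of_le (by exact_mod_cast (Nat.le_of_succ_le hm))
    have hFm : ContDiff ℝ m (fderiv ℝ F) := hF.fderiv_right hmN
    rw [← norm_iteratedFDeriv_fderiv, hfd]
    refine (B.norm_iteratedFDeriv_le_of_bilinear_of_le_one hG₁m hFm φ le_rfl hBn).trans ?_
    refine sum_le_sum fun i hi => ?_
    have him : i ≤ m := Nat.lt_succ_iff.1 (mem_range.1 hi)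
    have h1 := hG₁b i (by omega)
    rw [norm_iteratedFDeriv_fderiv, show m - i + 1 = m + 1 - i by omega]
    have h2 : 0 ≤ ‖iteratedFDeriv ℝ (m + 1 - i) F φ‖ := norm_nonneg _
    gcongr
  -- sum up
  have hz0 : 0 ≤ ‖z‖ := norm_nonneg _
  have hgen := sum_bellMajorant_second_le hfn hz0 N h𝔥
  have hw : ∑ k ∈ range N, f (k + 1) * 𝔥 ^ (k + 1) / ((k + 1)! : ℝ) = a - ‖z‖ := by
    rw [ha, tphiSeminorm_eq_norm_add, ← hz, add_sub_cancel_left]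
    exact sum_congr rfl fun k _ => by simp only [hf]; ring
  rw [hw] at hgen
  rw [tphiSeminorm_eq_norm_add]
  have hsum : ∑ p ∈ range N, 𝔥 ^ (p + 1) / ((p + 1)! : ℝ) * ‖iteratedFDeriv ℝ (p + 1) G₂ φ‖ ≤
      ∑ n ∈ range N, 𝔥 ^ (n + 1) / ((n + 1)! : ℝ) *
        ∑ i ∈ range (n + 1), (n.choose i : ℝ) *
          (if i = 0 then Real.exp ‖z‖ - 1 else Real.exp ‖z‖ * bellMajorant f i) * f (n + 1 - i) :=
    sum_le_sum fun p hp => mul_le_mul_of_nonneg_left (hder p (mem_range.1 hp)) (by positivity)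
  have hG₂φ : ‖G₂ φ‖ = ‖Complex.exp z - 1 - z‖ := rfl
  rw [hG₂φ]
  have : Real.exp (‖z‖ + (a - ‖z‖)) = Real.exp a := by ring_nf
  rw [this] at hgen
  linarith

/-- **`‖e^F − 1 − F‖_{T_φ(𝔥)} ≤ ‖F‖²_{T_φ(𝔥)} e^{‖F‖_{T_φ(𝔥)}}`** for complex `F` of class `C^N`.
[cite: AdamsBuchholzKoteckyMuller2019, Lemma 9.3 (9.13)] -/
theorem tphiSeminorm_cexp_sub_one_sub_le (N : ℕ) {𝔥 : ℝ} (h𝔥 : 0 ≤ 𝔥) {F : E → ℂ}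
    (hF : ContDiff ℝ N F) (φ : E) :
    tphiSeminorm N 𝔥 (fun x => Complex.exp (F x) - 1 - F x) φ ≤
      tphiSeminorm N 𝔥 F φ ^ 2 * Real.exp (tphiSeminorm N 𝔥 F φ) :=
  (tphiSeminorm_cexp_sub_one_sub_le_exp N h𝔥 hF φ).trans
    (exp_sub_one_sub_le_sq_mul_exp (tphiSeminorm_nonneg N h𝔥 F φ))

end Tphi

end Literature.MathematicalPhysics.QuantumFieldTheory

end
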